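import Literature.Topology.FourManifolds.SphereFourOneZeroOneSplitting
import Literature.Topology.FourManifolds.OneZeroOneHandlebodyBoundary
import Literature.Topology.FourManifolds.KnotTraceUniqueness
import HarnessLib

/-!
# The trace bridge T reduced to three handle-theoretic pieces, the uniqueness of the trace being proved

Topic `Literature/Topology/FourManifolds` (support file for the named fact (T)
`Literature.Topology.FourManifolds.exists_framedKnot_of_hasHandleDecomposition_oneZeroOne` of
`PropertyRTraceClosing.lean` — *a compact `4`-dimensional `(1,0,1)`-handlebody is the trace of a
framed knot `(K, n)`; its boundary is the surgery `S³ₙ(K)`, and the trace of the `0`-framed unknot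
closes up to the round `S⁴` with a `(1,1)`-handlebody complement*; Kirby, *The Topology of
4-Manifolds* (1989), Ch. I §1–§2; Milnor, *Lectures on the h-cobordism theorem* (1965), §3;
Kosinski, *Differential Manifolds* (1993), VI (6.6), VII (2.2)).  Everything here is **proved**;
no definition and no named fact is introduced.

`OneZeroOneHandlebodyBoundary.lean` proves clause (i) of T in Milnor's language (levels of a
Morse function, the tube of the left-hand circle) and reduces T to the uniqueness of the
`0`-framed unknot trace in that language (hypothesis `hU` of
`exists_framedKnot_of_hasHandleDecomposition_oneZeroOne_of_model`).  This file records the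
parallel reduction in the language of Kosinski attaching maps, in which **the uniqueness of the
trace is now a theorem** (`FramedLink.IsTrace.nonempty_diffeomorph_of_isIsotopic`,
`KnotTraceUniqueness.lean`, resting on the proved isotopy invariance of `2`-handle attachment ISO,
`Geometry/Symplectic/TwoHandleIsotopyHolds.lean`, and the diffeotopy form of the uniqueness of
framed tubes, `FramedTubeDiffeotopy.lean`).  What remains of T are three pieces, spelled out as
hypotheses of `exists_framedKnot_of_hasHandleDecomposition_oneZeroOne_of_trace`:

* **(P1) Morse → trace** (`hP1`): a compact `(1,0,1)`-handlebody `P` is the trace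
  `(FramedLink.single K n).IsTrace P` of some framed knot — Kosinski VII (2.2) (an elementary
  cobordism of index `2` is a `2`-handle attachment in the sense of VI §6; the tree's
  `HandleSlabLevel.lean` carries Parts 2–4 of that proof) over the `4`-disc below the critical
  point of index `2` (Milnor 1963, Thm. 3.1, `IsMorseAdapted.nonempty_diffeomorph_closedBall`),
  the boundary tube read as an oriented tubular neighbourhood in `S³ = ∂B⁴`
  (`LickorishTwist.exists_tubularNbhd_of_tube`, `Knot.TubularNbhd.exists_hasFraming`);
* **(P2) ∂(trace) = surgery** (`hP2`): the boundary of a trace of `(K, n)` is the integral surgery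
  `S³ₙ(K)` (`IsIntegralSurgery (𝓡 3) bP.carrier K n`) — Kirby (1989), Ch. I Lemma 2.1 and §5
  (`∂M_L` is surgery on `L`); on `T ∩ ∂D⁴` Kosinski's identification `x ∼ h̄ α(x)` is literally the
  tree's `surgeryRel ν`, cf. the scope notes of `DottedCircleDiagram.lean` and `RLinkSphere.lean`;
* **(P4) the model** (`hP4`): SOME trace `P₁` of the `0`-framed unknot is one piece of a splitting
  of the round sphere `S⁴ = P₁ ∪_{φ₁} V₁` whose other piece is a compact connected orientable
  `(1,1)`-handlebody (Kirby 1989, Ch. I §2, p. 8: `X₀(U) = S² × B²`, `S⁴ = S² × B² ∪ S¹ × B³`).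

Given these, T follows (`exists_framedKnot_of_hasHandleDecomposition_oneZeroOne_of_trace`): clause
(i) is (P1) with (P2); for clause (ii), if `K` is the unknot and `n = 0`, then `P` and `P₁` are
traces of isotopic framed knots with the same framing, hence diffeomorphic (trace uniqueness), and
the splitting of `S⁴` is transported along the diffeomorphism (`IsBoundaryGluing.transfer`,
`BoundaryData.restrictDiffeomorph`).

## References

* R. C. Kirby, *The Topology of 4-Manifolds*, LNM 1374 (1989), Ch. I §1, §2 (p. 8), Lemma 2.1,
  §5. [Kirby1989]
* A. A. Kosinski, *Differential Manifolds*, Academic Press (1993), VI §6, (6.6); VII (2.2).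
  [Kosinski1993]
* J. Milnor, *Lectures on the h-cobordism theorem* (1965), Thm. 3.13, §3 p. 21.
  [MilnorHCobordism1965]
* R. E. Gompf, A. I. Stipsicz, *4-Manifolds and Kirby Calculus* (1999), §4.4, §5.3.
  [GompfStipsicz1999]
-/

noncomputable section

open Set Function
open scoped Manifold ContDiff Topology

namespace Literature.Topology.FourManifolds

/-- **T from (P1) Morse → trace, (P2) ∂(trace) = surgery and (P4) a closed-up model of the
`0`-framed unknot trace**, the uniqueness of the trace being the theorem
`FramedLink.IsTrace.nonempty_diffeomorph_of_isIsotopic`.  See the module docstring.  Kirby (1989),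
Ch. I §1–§2 (the trace `M_L` of a framed link, `∂M_L`, closing up `M_L`; handlebodies are
determined by the isotopy classes of the attaching maps); Kosinski (1993), VI (6.6) and VII (2.2).
[cite: Kirby1989, Ch. I §1 and §2 (p. 8)] [cite: Kosinski1993, VI (6.6) and VII (2.2)] -/
theorem exists_framedKnot_of_hasHandleDecomposition_oneZeroOne_of_trace
    (hP1 : ∀ (P : Type) [TopologicalSpace P] [T2Space P] [SecondCountableTopology P]
      [ChartedSpace (EuclideanHalfSpace 4) P] [IsManifold (𝓡∂ 4) ∞ P] [CompactSpace P],
      HasHandleDecomposition 3 P (fun k => if k = 0 then 1 else if k = 2 then 1 else 0) →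
      ∃ (K : Knot) (n : ℤ), (FramedLink.single K n).IsTrace P)
    (hP2 : ∀ (P : Type) [TopologicalSpace P] [T2Space P] [SecondCountableTopology P]
      [ChartedSpace (EuclideanHalfSpace 4) P] [IsManifold (𝓡∂ 4) ∞ P] [CompactSpace P]
      (K : Knot) (n : ℤ), (FramedLink.single K n).IsTrace P →
      ∀ bP : BoundaryData (𝓡∂ 4) P (𝓡 3), IsIntegralSurgery (𝓡 3) bP.carrier K n)
    (hP4 : ∃ (P₁ : Type) (_ : TopologicalSpace P₁) (_ : ChartedSpace (EuclideanHalfSpace 4) P₁)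
      (_ : IsManifold (𝓡∂ 4) ∞ P₁)
      (V₁ : Type) (_ : TopologicalSpace V₁) (_ : T2Space V₁) (_ : SecondCountableTopology V₁)
      (_ : ChartedSpace (EuclideanHalfSpace 4) V₁) (_ : IsManifold (𝓡∂ 4) ∞ V₁)
      (_ : CompactSpace V₁) (_ : ConnectedSpace V₁)
      (bP₁ : BoundaryData (𝓡∂ 4) P₁ (𝓡 3)) (bV₁ : BoundaryData (𝓡∂ 4) V₁ (𝓡 3))
      (φ₁ : bP₁.carrier ≃ₘ⟮𝓡 3, 𝓡 3⟯ bV₁.carrier),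
      (FramedLink.single unknot 0).IsTrace P₁ ∧ HasHandleDecomposition 3 V₁ (handleCount 1 1) ∧
        IsOrientable (𝓡∂ 4) V₁ ∧
        IsBoundaryGluing bP₁ bV₁ φ₁ (𝓡 4) (Metric.sphere (0 : EuclideanSpace ℝ (Fin 5)) 1)) :
    exists_framedKnot_of_hasHandleDecomposition_oneZeroOne := by
  intro P _ _ _ _ _ _ hP bP
  obtain ⟨K, n, hT⟩ := hP1 P hP
  refine ⟨K, n, hP2 P K n hT bP, fun hK hn => ?_⟩
  subst hn
  obtain ⟨P₁, _, _, _, V₁, _, _, _, _, _, _, _, bP₁, bV₁, φ₁, hT₁, hV₁, hoV₁, hS⟩ := hP4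
  -- `K` is isotopic to the unknot, so the two traces are diffeomorphic
  obtain ⟨e⟩ := FramedLink.IsTrace.nonempty_diffeomorph_of_isIsotopic hT hT₁ hK
  exact ⟨V₁, inferInstance, inferInstance, inferInstance, inferInstance, inferInstance, inferInstance,
    inferInstance, bV₁, (bP.restrictDiffeomorph bP₁ e).trans φ₁, hV₁, hoV₁, by
      rw [Diffeomorph.coe_trans]; exact hS.transfer e⟩

/-- **The same with the model taken from the tree's splitting `S⁴ = P₀ ∪ V₀`**
(`exists_isBoundaryGluing_sphereFour_oneZeroOne_oneOne`, `SphereFourOneZeroOneSplitting.lean`: the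
sublevel and superlevel sets of a Morse function on `𝕊 4` with critical points of indices
`0, 2 | 3, 4`): then (P4) shrinks to **(P4') the model lower half `P₀` is a trace of the
`0`-framed unknot** (hypothesis `hP4'`, quantified over all such lower halves since the tree's
splitting theorem is existential), and T follows from (P1), (P2), (P4').  Kirby (1989), Ch. I §2,
p. 8: *"Adding a 2-handle to an unknot with zero framing gives `S² × B²`"*.
[cite: Kirby1989, Ch. I §2, p. 8] [cite: Kosinski1993, VI (6.6) and VII (2.2)] -/
theorem exists_framedKnot_of_hasHandleDecomposition_oneZeroOne_of_trace_of_lowerHalf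
    (hP1 : ∀ (P : Type) [TopologicalSpace P] [T2Space P] [SecondCountableTopology P]
      [ChartedSpace (EuclideanHalfSpace 4) P] [IsManifold (𝓡∂ 4) ∞ P] [CompactSpace P],
      HasHandleDecomposition 3 P (fun k => if k = 0 then 1 else if k = 2 then 1 else 0) →
      ∃ (K : Knot) (n : ℤ), (FramedLink.single K n).IsTrace P)
    (hP2 : ∀ (P : Type) [TopologicalSpace P] [T2Space P] [SecondCountableTopology P]
      [ChartedSpace (EuclideanHalfSpace 4) P] [IsManifold (𝓡∂ 4) ∞ P] [CompactSpace P]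
      (K : Knot) (n : ℤ), (FramedLink.single K n).IsTrace P →
      ∀ bP : BoundaryData (𝓡∂ 4) P (𝓡 3), IsIntegralSurgery (𝓡 3) bP.carrier K n)
    (hP4' : ∀ (P₀ : Type) [TopologicalSpace P₀] [T2Space P₀] [SecondCountableTopology P₀]
      [ChartedSpace (EuclideanHalfSpace 4) P₀] [IsManifold (𝓡∂ 4) ∞ P₀] [CompactSpace P₀]
      (V₀ : Type) [TopologicalSpace V₀] [T2Space V₀] [SecondCountableTopology V₀]
      [ChartedSpace (EuclideanHalfSpace 4) V₀] [IsManifold (𝓡∂ 4) ∞ V₀] [CompactSpace V₀]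
      (bP₀ : BoundaryData (𝓡∂ 4) P₀ (𝓡 3)) (bV₀ : BoundaryData (𝓡∂ 4) V₀ (𝓡 3))
      (φ₀ : bP₀.carrier ≃ₘ⟮𝓡 3, 𝓡 3⟯ bV₀.carrier),
      HasHandleDecomposition 3 P₀ (fun k => if k = 0 then 1 else if k = 2 then 1 else 0) →
      HasHandleDecomposition 3 V₀ (handleCount 1 1) →
      IsBoundaryGluing bP₀ bV₀ φ₀ (𝓡 4) (Metric.sphere (0 : EuclideanSpace ℝ (Fin 5)) 1) →
      (FramedLink.single unknot 0).IsTrace P₀) :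
    exists_framedKnot_of_hasHandleDecomposition_oneZeroOne := by
  obtain ⟨P₀, _, _, _, _, _, _, _, V₀, _, _, _, _, _, _, _, bP₀, bV₀, φ₀, hP₀, hV₀, -, hoV₀, hS⟩ :=
    exists_isBoundaryGluing_sphereFour_oneZeroOne_oneOne
  refine exists_framedKnot_of_hasHandleDecomposition_oneZeroOne_of_trace hP1 hP2
    ⟨P₀, inferInstance, inferInstance, inferInstance, V₀, inferInstance, inferInstance, inferInstance,
      inferInstance, inferInstance, inferInstance, inferInstance, bP₀, bV₀, φ₀,
      hP4' P₀ V₀ bP₀ bV₀ φ₀ hP₀ hV₀ hS, hV₀, hoV₀, hS⟩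

/-- **T from (P1') "the `(1,0,1)`-handlebody is the trace of ITS OWN Milnor framed knot" and the
model (P4)** — the variant of `exists_framedKnot_of_hasHandleDecomposition_oneZeroOne_of_trace` in
which the Morse-to-trace bridge is asked for the very framed knot `(Φ ∘ S_L(q), n)` produced by the
proved clause (i) (`exists_passageData_isIntegralSurgery_of_hasHandleDecomposition_oneZeroOne`,
`OneZeroOneHandlebodyBoundary.lean`: Morse function `g`, gradient-like field `ξ`, passage setting
`Ps` about the critical point `q` of index `2`, level `V ≅ S³` below it, the oriented tube `ν` of
the transported left-hand circle and its framing integer `n`), so that no separate computation of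
the boundary of a trace (P2) is needed: clause (i) is the proved one and clause (ii) follows from
(P1'), the uniqueness of the trace (`FramedLink.IsTrace.nonempty_diffeomorph_of_isIsotopic`) and
(P4) through `exists_framedKnot_of_hasHandleDecomposition_oneZeroOne_of_closing`.  (P1') is
Kosinski (1993), VII (2.2) read with Milnor's characteristic embedding (1965, Def. 3.9,
Thm. 3.13): the `2`-handle of the elementary cobordism through `q` is attached along the tube of
the left-hand circle. [cite: Kosinski1993, VII (2.2) and VI (6.6)]
[cite: MilnorHCobordism1965, Def. 3.9 and Thm. 3.13] [cite: Kirby1989, Ch. I §2, p. 8] -/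
theorem exists_framedKnot_of_hasHandleDecomposition_oneZeroOne_of_passageTrace
    (hP1' : ∀ (P : Type) [TopologicalSpace P] [T2Space P] [SecondCountableTopology P]
      [ChartedSpace (EuclideanHalfSpace 4) P] [IsManifold (𝓡∂ 4) ∞ P] [CompactSpace P]
      (g : P → ℝ) (_ : (Cobordism.ofBoundary 3 P).IsMorseFunction g) (p q : P)
      (_ : criticalSet (𝓡∂ (3 + 1)) g = {p, q}) (_ : morseIndex (𝓡∂ (3 + 1)) g p = 0)
      (_ : morseIndex (𝓡∂ (3 + 1)) g q = 2)
      (ξ : Cₛ^∞⟮𝓡∂ (3 + 1); EuclideanSpace ℝ (Fin (3 + 1)),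
        (TangentSpace (𝓡∂ (3 + 1)) : P → Type)⟯)
      (_ : IsGradientLike (𝓡∂ (3 + 1)) g ξ)
      (Ps : Cobordism.PassageSetting (Cobordism.ofBoundary 3 P) g ⇑ξ 1) (_ : Ps.q = q)
      (V : Type) [TopologicalSpace V] [T2Space V] [ChartedSpace (EuclideanSpace ℝ (Fin 3)) V]
      [IsManifold (𝓡 3) ∞ V] [Nonempty V] (ι : V → P)
      (hι : Manifold.IsSmoothEmbedding (𝓡 3) (𝓡∂ (3 + 1)) ∞ ι) (hιr : range ι = g ⁻¹' {Ps.b})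
      (Φ : V ≃ₘ⟮𝓡 3, 𝓡 3⟯ (Metric.sphere (0 : EuclideanSpace ℝ (Fin 4)) 1))
      (ν : Knot.TubularNbhd
        ⇑(LickorishTwist.knotOfTube ((Ps.isSmoothEmbedding_tubePH ι hι hιr).diffeomorph_comp Φ)))
      (n : ℤ),
      (⇑ν = ⇑Φ ∘ ⇑(Ps.tubePH ι hι hιr) ∨ ⇑ν = fibreReflect (⇑Φ ∘ ⇑(Ps.tubePH ι hι hιr))) →
      ν.HasFraming n →
      (FramedLink.single
        (LickorishTwist.knotOfTube ((Ps.isSmoothEmbedding_tubePH ι hι hιr).diffeomorph_comp Φ))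
        n).IsTrace P)
    (hP4 : ∃ (P₁ : Type) (_ : TopologicalSpace P₁) (_ : ChartedSpace (EuclideanHalfSpace 4) P₁)
      (_ : IsManifold (𝓡∂ 4) ∞ P₁)
      (V₁ : Type) (_ : TopologicalSpace V₁) (_ : T2Space V₁) (_ : SecondCountableTopology V₁)
      (_ : ChartedSpace (EuclideanHalfSpace 4) V₁) (_ : IsManifold (𝓡∂ 4) ∞ V₁)
      (_ : CompactSpace V₁) (_ : ConnectedSpace V₁)
      (bP₁ : BoundaryData (𝓡∂ 4) P₁ (𝓡 3)) (bV₁ : BoundaryData (𝓡∂ 4) V₁ (𝓡 3))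
      (φ₁ : bP₁.carrier ≃ₘ⟮𝓡 3, 𝓡 3⟯ bV₁.carrier),
      (FramedLink.single unknot 0).IsTrace P₁ ∧ HasHandleDecomposition 3 V₁ (handleCount 1 1) ∧
        IsOrientable (𝓡∂ 4) V₁ ∧
        IsBoundaryGluing bP₁ bV₁ φ₁ (𝓡 4) (Metric.sphere (0 : EuclideanSpace ℝ (Fin 5)) 1)) :
    exists_framedKnot_of_hasHandleDecomposition_oneZeroOne := by
  obtain ⟨P₁, _, _, _, V₁, _, _, _, _, _, _, _, bP₁, bV₁, φ₁, hT₁, hV₁, hoV₁, hS⟩ := hP4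
  refine exists_framedKnot_of_hasHandleDecomposition_oneZeroOne_of_closing
    fun P _ _ _ _ _ _ bP g hg p q hcrit hp hq ξ hξ Ps hPq V _ _ _ _ _ ι hι hιr Φ ν n hν hn hK h0 => ?_
  have hT := hP1' P g hg p q hcrit hp hq ξ hξ Ps hPq V ι hι hιr Φ ν n hν hn
  subst h0
  obtain ⟨e⟩ := FramedLink.IsTrace.nonempty_diffeomorph_of_isIsotopic hT hT₁ hK
  exact ⟨V₁, inferInstance, inferInstance, inferInstance, inferInstance, inferInstance, inferInstance,
    inferInstance, bV₁, (bP.restrictDiffeomorph bP₁ e).trans φ₁, hV₁, hoV₁, by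
      rw [Diffeomorph.coe_trans]; exact hS.transfer e⟩

end Literature.Topology.FourManifolds

end
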